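import Summits.QuantumFields.YangMills.Theses.EquipartitionCriticality
import Literature.Probability.LatticeModels.LatticeLaplacianZd
import Literature.MathematicalPhysics.QuantumFieldTheory.CurvatureGaussianField
import Literature.MathematicalPhysics.QuantumFieldTheory.LatticeLangevinDynamics

/-!
# Sketch — crux-ideate stmt-QuantumFields-8760 (`EquipartitionPinsProbe`), ideator 2, round 1

First lemmas of the two idea cards `stein-liouville-pinning` and `langevin-local-equilibration`,
typed over existing declarations only (nothing here is a route item; nothing is proved here).
-/

open MeasureTheory Filter Topology ProbabilityTheory
open scoped NNReal BigOperators
open Literature.Probability.LatticeModels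
open Literature.MathematicalPhysics.QuantumLattice
open Literature.MathematicalPhysics.QuantumFieldTheory

namespace Summit.QuantumFields.YangMills.Cruxes.EquipartitionPinsProbe.Ideator2

/-! ## Card `stein-liouville-pinning` -/

/-- (card 1, first lemma — replaces why-fail (ii) "harmonic part = E[Y|tail] = const")
**Bounded Liouville on `ℤ^d`**: a bounded function on `ℤ^d`, `d ≥ 1`, which is harmonic for the
nearest-neighbour Laplacian is constant. Applied componentwise to
`H = C(·,q) - G(·,q)` (tangent two-point function minus the Maxwell kernel), which is closed
(Bianchi) and co-closed (limiting one-link Schwinger–Dyson identity), hence Hodge-harmonic, hence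
componentwise `latticeLaplacianZd`-harmonic, and bounded by the equipartition budget. -/
def BoundedHarmonicLiouville : Prop :=
  ∀ (d : ℕ), 0 < d → ∀ H : Site d → ℝ, (∃ C : ℝ, ∀ x, |H x| ≤ C) →
    IsZdHarmonicOn H Set.univ → ∀ x y, H x = H y

/-- (card 1, second lemma — the Gaussianity engine, no moments beyond the first)
**Stein's characterisation of the centred normal law**: if `E[X f(X)] = v · E[f'(X)]` for every
bounded `C¹` test function with bounded derivative, then `X ∼ N(0, v)`. Proof route: with
`f = cos(t·), sin(t·)` the characteristic function solves `φ' = -v t φ`. In the line it is applied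
to `X = ⟨dh, Z⟩` for finitely supported `𝔤`-valued `1`-forms `h`: the limiting Schwinger–Dyson
identity in the exact direction `dh` is exactly Stein's identity with `v = |dh|²`. -/
def SteinCharacterisation : Prop :=
  ∀ (μ : Measure ℝ) [IsProbabilityMeasure μ] (v : ℝ≥0), v ≠ 0 →
    Integrable (fun x : ℝ => x) μ →
    (∀ f : ℝ → ℝ, ContDiff ℝ 1 f → (∃ C : ℝ, ∀ x, |f x| ≤ C ∧ |deriv f x| ≤ C) →
      ∫ x, x * f x ∂μ = (v : ℝ) * ∫ x, deriv f x ∂μ) →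
    μ = gaussianReal 0 v

/-- (card 1, lattice-level stub — the exact finite-`β` input, provable now)
**Haar-shift (finite-difference Schwinger–Dyson) identity on the torus**: left-multiplying one link
variable by a fixed `g ∈ G` is absorbed by the Haar measure and reweights the Wilson density; its
derivative at `g = exp(tX)`, `X ∈ 𝔤`, is the one-link integration-by-parts identity
`E[∇_{e,X} f] = β E[f ∇_{e,X} S]` whose `β → ∞` limit is Stein's equation for lattice Maxwell ⊗ 𝔤.
It passes verbatim to torus-limit states for bounded continuous cylinder `f`. -/
def HaarShiftIdentity : Prop :=
  ∀ (G : Type) [Group G] [TopologicalSpace G] [IsTopologicalGroup G] [CompactSpace G]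
    [MeasurableSpace G] [BorelSpace G] (r : LatticeRep G) (d L : ℕ) [NeZero L] (β : ℝ)
    (e : Edge d L) (g : G) (f : GaugeConfig d L G → ℝ), Measurable f → (∃ C : ℝ, ∀ U, |f U| ≤ C) →
    ∫ U, f (Function.update U e (g * U e)) ∂(wilsonMeasure (d := d) (L := L) r.ρ β) =
      ∫ U, f U * Real.exp (-(β * (wilsonAction (d := d) (L := L) r.ρ
          (Function.update U e (g⁻¹ * U e)) - wilsonAction (d := d) (L := L) r.ρ U)))
        ∂(wilsonMeasure (d := d) (L := L) r.ρ β)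

/-! ## Shared first stub (both cards): the uniform equipartition budget enters through Griffiths'
lemma — every torus-limit state's site energy is a subgradient of the pressure. With the route's
proved support item `SubgradientLogSqueeze` this gives `β · E_μ[∑_{i<j}(N - P_{0,ij})] → 3D/2`
uniformly over `μ ∈ infiniteVolumeLimitPoints r.ρ β`. -/

/-- **Torus-limit energy densities are subgradients of the free energy** (Griffiths 1964 / Ruelle):
for `μ ∈ infiniteVolumeLimitPoints r.ρ β`, `p := -E_μ[site action at 0]` satisfies
`f(β) + p (y - β) ≤ f(y)` for all real `y`, `f = freeEnergyDensity 4 r.ρ` (convex, finite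
everywhere: tree `exists_hasFreeEnergyDensity_holds`). -/
def SubgradientOfTorusLimit : Prop :=
  ∀ (G : Type) [Group G] [TopologicalSpace G] [IsTopologicalGroup G] [CompactSpace G],
    IsCompactSimpleLieGroup G → letI : MeasurableSpace G := borel G; haveI : BorelSpace G := ⟨rfl⟩;
    ∀ (r : LatticeRep G) (β : ℝ), ∀ μ ∈ infiniteVolumeLimitPoints (d := 4) r.ρ β, ∀ y : ℝ,
      freeEnergyDensity 4 r.ρ β +
          (-(∫ U, (∑ i : Fin 4, ∑ j : Fin 4,
              if i < j then ((r.N : ℝ) - plaquetteObs r.ρ 0 i j U) else 0) ∂μ)) * (y - β) ≤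
        freeEnergyDensity 4 r.ρ y

/-! ## Card `langevin-local-equilibration` -/

/-- (card 2, first lattice-level stub — scope extension of the tree's vendored SZZ facts)
**Wilson's torus measure is invariant for the lattice Langevin dynamics for EVERY compact `G` with
faithful unitary `r`** (SZZ Lemma 3.2 is printed for `SO(N)`/`SU(N)`; the proof — Haar integration
by parts, `L1 = 0` — is scope-free). This is the body of `WilsonMeasureLangevinInvariant` without the
`IsClassicalDefining` guard. In the line, invariance at time `t = τ/β` is what is linearised. -/
def TorusLangevinInvariant : Prop :=
  ∀ (G : Type) [Group G] [TopologicalSpace G] [IsTopologicalGroup G] [CompactSpace G]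
    [MeasurableSpace G] [BorelSpace G] (r : LatticeRep G) (d L : ℕ) [NeZero L] (β : ℝ)
    (Ω : Type) [MeasurableSpace Ω] (P : Measure Ω) [IsProbabilityMeasure P]
    (W : ℝ≥0 → Ω → (Edge d L × NoiseIdx r.N → ℝ)) (hW : IsFlatBrownian W P)
    (U : GaugeConfig d L G → ℝ≥0 → Ω → GaugeConfig d L G),
    (∀ x, (∀ ω, U x 0 ω = x) ∧
      (latticeLangevinDynamics r β).IsSolution r.ρ hW.natFiltration P W (U x)) →
    ∀ (f : GaugeConfig d L G → ℝ), Measurable f → (∃ C : ℝ, ∀ y, |f y| ≤ C) → ∀ t : ℝ≥0,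
      ∫ x, markovTransition U P t f x ∂(wilsonMeasure (d := d) (L := L) r.ρ β) =
        ∫ x, f x ∂(wilsonMeasure (d := d) (L := L) r.ρ β)

/-- (card 2, identification lemma in its typable shadow — "OU fixed point under a variance ceiling")
**Variance ceiling pins the Gaussian**: a probability measure on `ℝ^D`-valued plaquette fields of
`ℤ^4` under which the plaquette variables form a centred Gaussian process whose covariance is
DOMINATED BY and has the SAME DIAGONAL as the Maxwell ⊗ `1_D` kernel is `curvatureGaussianField 4 D`.
(In the line: `Z = lim G_{nτ} ⊕ remainder`, the Gaussian part has covariance `↑ C`, the remainder is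
`L²`-orthogonal, and the budget `E|Z_p|² ≤ C_pp` squeezes the remainder to `0`; this lemma is the
last, purely Gaussian step: dominated + equal diagonal + both PSD ⇒ equal.) -/
def VarianceCeilingPinsGaussian : Prop :=
  ∀ (D : ℕ) (ν : Measure (ZdPlaquette 4 → (Fin D → ℝ))) [IsProbabilityMeasure ν]
    (K : (ZdPlaquette 4 × Fin D) → (ZdPlaquette 4 × Fin D) → ℝ),
    IsPosSemidefKernel K →
    IsPosSemidefKernel (fun s t => curvatureCovKernel 4 D s t - K s t) →
    (∀ s, K s s = curvatureCovKernel 4 D s s) →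
    IsGaussianProcess (fun (s : ZdPlaquette 4 × Fin D) (Y : ZdPlaquette 4 → (Fin D → ℝ)) => Y s.1 s.2) ν →
    (∀ s : ZdPlaquette 4 × Fin D, ∫ Y, Y s.1 s.2 ∂ν = 0) →
    (∀ s t : ZdPlaquette 4 × Fin D, ∫ Y, Y s.1 s.2 * Y t.1 t.2 ∂ν = K s t) →
    ν = curvatureGaussianField 4 D

/-! ## The crux, for reference: both lines conclude it BY NAME. -/
example : Prop := Summit.QuantumFields.YangMills.Theses.EquipartitionCriticality.EquipartitionPinsProbe

end Summit.QuantumFields.YangMills.Cruxes.EquipartitionPinsProbe.Ideator2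

namespace Summit.QuantumFields.YangMills.Cruxes.EquipartitionPinsProbe.Ideator2

open MeasureTheory ProbabilityTheory
open Literature.MathematicalPhysics.QuantumLattice Literature.MathematicalPhysics.QuantumFieldTheory

/-! ## Card `heat-bath-gibbs-pythagoras` -/

/-- (card 3, first lemma — why-fail (ii) becomes nothing)
**The equipartition budget kills any INDEPENDENT summand**: if the tangent curvature field is
`Z = Y + H` with `Y ∼ curvatureGaussianField 4 D` independent of `H` (the shape the
Dobrushin–Georgii structure theorem gives every Gibbs measure of a Gaussian specification, `H`
the random harmonic part) and the plaquette second moments of `Z` do not exceed the Maxwell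
value `2/d = 1/2`, then `H = 0` almost surely — by `E(Y+H)² = EY² + EH² + 2·EY·EH` and `EY = 0`;
no classification of harmonic fields (constants, Liouville, spectral atoms) is needed. -/
def IndependentNoiseKilledByBudget : Prop :=
  ∀ (D : ℕ) (Ω : Type) [MeasurableSpace Ω] (P : Measure Ω) [IsProbabilityMeasure P]
    (Y H : Ω → (ZdPlaquette 4 → (Fin D → ℝ))), Measurable Y → Measurable H →
    IndepFun Y H P → P.map Y = curvatureGaussianField 4 D →
    (∀ (p : ZdPlaquette 4) (a : Fin D), Integrable (fun ω => (Y ω p a) ^ 2) P) →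
    (∀ (p : ZdPlaquette 4) (a : Fin D), Integrable (fun ω => (H ω p a) ^ 2) P) →
    (∀ (p : ZdPlaquette 4) (a : Fin D), ∫ ω, (Y ω p a + H ω p a) ^ 2 ∂P ≤ (2 : ℝ) / 4) →
    ∀ (p : ZdPlaquette 4) (a : Fin D), (fun ω => H ω p a) =ᵐ[P] 0

end Summit.QuantumFields.YangMills.Cruxes.EquipartitionPinsProbe.Ideator2
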